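import Summits.CriticalPhenomena.PercolationContinuityZ3.Theorems.PercNearOneGluingNoHeavyLowerTailSahiOneStepProfileGridAndOr
import Summits.CriticalPhenomena.PercolationContinuityZ3.Theorems.PercNearOneGluingNoHeavyLowerTailSahiOneStepDisjointOr
import HarnessLib

/-!
# One-step scheme: `(2′)` and Kahn C5 / Sahi `C₃` for an AND OF THRESHOLDS OF DISJOINT BLOCKS (intersected with an OR of such
# thresholds) against an ARBITRARY increasing event, every product measure

Prover prim-ineq-prove-3 gen 45 (`--supports stmt-CriticalPhenomena-4575`; memo
`run/shared/lean/prim/prim-ineq-prove-3/PROOF-G45-CHAIN-RULE.md`).  Cube corollary of the profile-grid theorem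
`ProfileGrid.grid_osN_andOr_nonneg` (`…SahiOneStepProfileGridAndOr`, the CHAIN RULE bootstrapping of gen 44's OR theorem); the
push-forward to the profile grid is the one of `…SahiOneStepDisjointOr` (gen 44).  No definitions, no sorries.

* `osN_threshold_disjointBoxOr_nonneg` — for every product measure, every block `F`, every `t`, every finite family of pairwise
  DISJOINT blocks `S_j ⊆ F` with lower thresholds `c_j` and OR-thresholds `r_j`, and EVERY increasing `U`:
  `0 ≤ n(1_U, 1_B)` at the slot `{N_F ≥ t}` for `B = {∀ j, N_{S_j} ≥ c_j} ∩ {∃ j, N_{S_j} ≥ r_j}`.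
* `osN_threshold_disjointAnd_nonneg` — the same for `B = ⋂_j {N_{S_j} ≥ c_j}`, an **AND of thresholds of disjoint blocks**
  (e.g. every read-once monotone CNF of block thresholds with one literal per clause, `x_{S₁} ∧ (N_{S₂} ≥ 2) ∧ …`; with gen 26's
  AND-literal step only ONE block threshold could be combined with literals).
* `sahiE3_threshold_disjointBoxOr_nonneg(')`, `sahiE3_threshold_disjointAnd_nonneg(')` — with the `(3′)` half
  (`osMp_threshold_nonneg_all`): **Kahn C5 / Sahi `C₃`** `0 ≤ E₃(1_{N_F ≥ t}, 1_U, 1_B)` for these `B`, both slot orders.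
New beyond the tree: two block thresholds plus free coordinates, or `≥ 3` block thresholds (two blocks without free coordinates =
gen-24 two-chain theorem; one block = gen-20 THEOREM A; block ∧ literals = gen 26).
-/

noncomputable section

namespace Summit.CriticalPhenomena.PercolationContinuityZ3.Theorems

namespace SahiOneStep

open MeasureTheory Finset Function
open Literature.Probability.LatticeModels (prodBernoulli sahiE3)
open Literature.Probability.Percolation.DecisionTree (ind)
open Literature.Probability.Distributions (IsLogConcaveSeq piWeight blockSum)
open scoped Classical

variable {ι : Type*} [Fintype ι] [DecidableEq ι]

/-! ## The push-forward (as in `…SahiOneStepDisjointOr`) for a box-and-OR profile event -/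

/-- **Core push-forward.**  Blocks `R = F ∖ ⋃ S_j` (index `none`) and `S_j` (index `some j`); if the cube event `B` is
`{(∀ j, c'_j ≤ N_{blk j}) ∧ (∃ j, r'_j ≤ N_{blk j})}` for thresholds `c', r'` on `Option κ₀`, then `0 ≤ n(1_U, 1_B)` at `{N_F ≥ t}` for
every increasing `U`. [this work] -/
theorem osN_threshold_profileBoxOr_nonneg (p : ι → unitInterval) (F : Finset ι) (t : ℕ) {κ₀ : Type*} [Fintype κ₀] [DecidableEq κ₀]
    (S : κ₀ → Finset ι) (hSF : ∀ j, S j ⊆ F) (hdisj : ∀ j j', j ≠ j' → Disjoint (S j) (S j')) (c' r' : Option κ₀ → ℕ)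
    {U : Set (Set ι)} (hU : IsUpperSet U) {B : Set (Set ι)}
    (hB : ∀ ω, ω ∈ B ↔ (∀ j, c' j ≤ ((Option.elim j (F \ univ.biUnion S) S).filter (· ∈ ω)).card) ∧
      ∃ j, r' j ≤ ((Option.elim j (F \ univ.biUnion S) S).filter (· ∈ ω)).card) :
    0 ≤ osN p {ω : Set ι | t ≤ (F.filter (· ∈ ω)).card} (ind U) (ind B) := by
  set N : ℕ := F.card with hN
  set blk : Option κ₀ → Finset ι := fun j => Option.elim j (F \ univ.biUnion S) S with hblk
  have hblkF : ∀ j, blk j ⊆ F := fun j => by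
    cases j with
    | none => exact sdiff_subset
    | some j => exact hSF j
  have hblkN : ∀ j, (blk j).card ≤ N := fun j => card_le_card (hblkF j)
  have hblkdisj : ∀ j j', j ≠ j' → Disjoint (blk j) (blk j') := by
    intro j j' hjj'
    cases j with
    | none =>
      cases j' with
      | none => exact absurd rfl hjj'
      | some b => exact Finset.sdiff_disjoint.mono_right (subset_biUnion_of_mem S (mem_univ b))
    | some a =>
      cases j' with
      | none => exact (Finset.sdiff_disjoint.mono_right (subset_biUnion_of_mem S (mem_univ a))).symm
      | some b => exact hdisj a b (fun h => hjj' (by rw [h]))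
  have hFeq : F = univ.biUnion blk := by
    ext i
    simp only [mem_biUnion, mem_univ, true_and]
    constructor
    · intro hi
      by_cases h : ∃ j, i ∈ S j
      · obtain ⟨j, hj⟩ := h; exact ⟨some j, hj⟩
      · refine ⟨none, ?_⟩
        show i ∈ F \ univ.biUnion S
        rw [mem_sdiff, mem_biUnion]; exact ⟨hi, fun ⟨j, _, hj⟩ => h ⟨j, hj⟩⟩
    · rintro ⟨j, hj⟩; exact hblkF j hj
  have hcardF : ∀ ω : Set ι, (F.filter (· ∈ ω)).card = ∑ j, ((blk j).filter (· ∈ ω)).card := by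
    intro ω
    rw [hFeq, filter_biUnion, card_biUnion]
    intro j _ j' _ hjj'
    exact disjoint_filter_filter (hblkdisj j j' hjj')
  set φ : Option κ₀ → ℕ → ℝ := fun j n => (prodBernoulli p).real {ω : Set ι | ((blk j).filter (· ∈ ω)).card = n} with hφ
  set u : (Option κ₀ → Fin (N + 1)) → ℝ := fun v => (prodBernoulli p).real (U ∩ {ω : Set ι | prof blk N hblkN ω = v}) with hu
  have hφlc : ∀ j, IsLogConcaveSeq (φ j) := fun j => isLogConcaveSeq_real_layer p (blk j)
  have hφ1 : ∀ j, ∑ n : Fin (N + 1), φ j n = 1 := by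
    intro j
    rw [Fin.sum_univ_eq_sum_range (fun n => φ j n) (N + 1), ← sum_real_layer_eq_one p (blk j),
      ← sum_range_add_sum_Ico _ (show (blk j).card + 1 ≤ N + 1 by have := hblkN j; omega)]
    rw [sum_eq_zero (s := Ico ((blk j).card + 1) (N + 1)) (fun n hn => by
      have hn' := (mem_Ico.1 hn).1
      simp only [hφ]
      rw [show {ω : Set ι | ((blk j).filter (· ∈ ω)).card = n} = ∅ from by
        ext ω; simp only [Set.mem_setOf_eq, Set.mem_empty_iff_false, iff_false]
        intro h; have := card_filter_le (blk j) (· ∈ ω); omega]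
      exact measureReal_empty), add_zero]
  have hu0 : ∀ v, 0 ≤ u v := fun v => measureReal_nonneg
  have hcell : ∀ v : Option κ₀ → Fin (N + 1), (prodBernoulli p).real {ω : Set ι | prof blk N hblkN ω = v} = piWeight N φ v :=
    fun v => real_prof_eq_prod p blk hblkdisj N hblkN v
  have huΦ : ∀ v, u v ≤ piWeight N φ v := fun v => by
    rw [← hcell]; exact measureReal_mono Set.inter_subset_right
  have hmono : ∀ v j (x x' : Fin (N + 1)), x ≤ x' → u (update v j x) * φ j x' ≤ u (update v j x') * φ j x :=
    fun v j x x' hxx' => real_inter_prof_update_mul_le p blk hblkdisj N hblkN hU v j hxx'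
  have hgrid := ProfileGrid.grid_osN_andOr_nonneg φ hφlc hφ1 c' r' t u hu0 huΦ hmono
  set H : Set (Set ι) := {ω : Set ι | t ≤ (F.filter (· ∈ ω)).card} with hH
  have memH : ∀ ω : Set ι, ω ∈ H ↔ t ≤ blockSum univ (prof blk N hblkN ω) := fun ω => by
    rw [hH, Set.mem_setOf_eq, hcardF ω, blockSum]; simp only [prof_val]
  have memB : ∀ ω : Set ι, ω ∈ B ↔
      (∀ j, c' j ≤ (prof blk N hblkN ω j : ℕ)) ∧ ∃ j, r' j ≤ (prof blk N hblkN ω j : ℕ) := fun ω => by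
    rw [hB ω]; simp only [prof_val, hblk]
  have memHB : ∀ ω : Set ι, ω ∈ H ∩ B ↔ t ≤ blockSum univ (prof blk N hblkN ω) ∧
      ((∀ j, c' j ≤ (prof blk N hblkN ω j : ℕ)) ∧ ∃ j, r' j ≤ (prof blk N hblkN ω j : ℕ)) := fun ω => by
    rw [Set.mem_inter_iff, memH, memB]
  -- the five measures as grid sums
  have eHU : (prodBernoulli p).real (H ∩ U) =
      ∑ v : Option κ₀ → Fin (N + 1), if t ≤ blockSum univ v then u v else 0 := by
    rw [real_eq_sum_prof p blk N hblkN]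
    exact Fintype.sum_congr _ _ fun v =>
      real_inter_prof_eq_ite p blk N hblkN (E := H) (X := U) (fun v => t ≤ blockSum univ v) memH v
  have eHB : (prodBernoulli p).real (H ∩ B) = ∑ v : Option κ₀ → Fin (N + 1),
      if t ≤ blockSum univ v ∧ ((∀ j, c' j ≤ (v j : ℕ)) ∧ ∃ j, r' j ≤ (v j : ℕ)) then piWeight N φ v else 0 := by
    rw [real_eq_sum_prof p blk N hblkN]
    refine Fintype.sum_congr _ _ fun v => ?_
    rw [← Set.inter_univ (H ∩ B), real_inter_prof_eq_ite p blk N hblkN (E := H ∩ B) (X := Set.univ)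
      (fun v => t ≤ blockSum univ v ∧ ((∀ j, c' j ≤ (v j : ℕ)) ∧ ∃ j, r' j ≤ (v j : ℕ))) memHB v, Set.univ_inter, hcell]
  have eH : (prodBernoulli p).real H = ∑ v : Option κ₀ → Fin (N + 1), if t ≤ blockSum univ v then piWeight N φ v else 0 := by
    rw [real_eq_sum_prof p blk N hblkN]
    refine Fintype.sum_congr _ _ fun v => ?_
    rw [← Set.inter_univ H, real_inter_prof_eq_ite p blk N hblkN (E := H) (X := Set.univ) (fun v => t ≤ blockSum univ v) memH v,
      Set.univ_inter, hcell]
  have eHUB : (prodBernoulli p).real (H ∩ U ∩ B) = ∑ v : Option κ₀ → Fin (N + 1),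
      if t ≤ blockSum univ v ∧ ((∀ j, c' j ≤ (v j : ℕ)) ∧ ∃ j, r' j ≤ (v j : ℕ)) then u v else 0 := by
    rw [show H ∩ U ∩ B = (H ∩ B) ∩ U from by rw [Set.inter_assoc, Set.inter_comm U B, ← Set.inter_assoc],
      real_eq_sum_prof p blk N hblkN]
    exact Fintype.sum_congr _ _ fun v => real_inter_prof_eq_ite p blk N hblkN (E := H ∩ B) (X := U)
      (fun v => t ≤ blockSum univ v ∧ ((∀ j, c' j ≤ (v j : ℕ)) ∧ ∃ j, r' j ≤ (v j : ℕ))) memHB v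
  have eU : (prodBernoulli p).real U = ∑ v : Option κ₀ → Fin (N + 1), u v := real_eq_sum_prof p blk N hblkN U
  have eB : (prodBernoulli p).real B = ∑ v : Option κ₀ → Fin (N + 1),
      if ((∀ j, c' j ≤ (v j : ℕ)) ∧ ∃ j, r' j ≤ (v j : ℕ)) then piWeight N φ v else 0 := by
    rw [real_eq_sum_prof p blk N hblkN]
    refine Fintype.sum_congr _ _ fun v => ?_
    rw [← Set.inter_univ B, real_inter_prof_eq_ite p blk N hblkN (E := B) (X := Set.univ)
      (fun v => (∀ j, c' j ≤ (v j : ℕ)) ∧ ∃ j, r' j ≤ (v j : ℕ)) memB v, Set.univ_inter, hcell]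
  rw [osN_ind_ind, eHU, eHB, eH, eHUB, eU, eB]
  exact hgrid

omit [Fintype ι] in
/-- The block count of the free block `F ∖ ⋃ S_j` is at most `|F|`. [folklore] -/
theorem card_filter_free_le (F : Finset ι) {κ₀ : Type*} [Fintype κ₀] (S : κ₀ → Finset ι) (ω : Set ι) :
    ((F \ univ.biUnion S).filter (· ∈ ω)).card ≤ F.card :=
  (card_filter_le _ _).trans (card_le_card sdiff_subset)

/-! ## THE THEOREMS -/

/-- **`(2′)` FOR A BOX-AND-OR OF THRESHOLDS OF DISJOINT BLOCKS.**  For every product measure, every block `F`, every `t`, every finite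
family of pairwise disjoint `S_j ⊆ F` with lower thresholds `c_j` and OR-thresholds `r_j`, and EVERY increasing event `U`:
`0 ≤ n(1_U, 1_B)` at the slot `{N_F ≥ t}`, `B = {ω : (∀ j, c_j ≤ N_{S_j}(ω)) ∧ ∃ j, r_j ≤ N_{S_j}(ω)}`. [this work] -/
theorem osN_threshold_disjointBoxOr_nonneg (p : ι → unitInterval) (F : Finset ι) (t : ℕ) {κ₀ : Type*} [Fintype κ₀]
    [DecidableEq κ₀] (S : κ₀ → Finset ι) (hSF : ∀ j, S j ⊆ F) (hdisj : ∀ j j', j ≠ j' → Disjoint (S j) (S j')) (c r : κ₀ → ℕ)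
    {U : Set (Set ι)} (hU : IsUpperSet U) :
    0 ≤ osN p {ω : Set ι | t ≤ (F.filter (· ∈ ω)).card} (ind U)
      (ind {ω : Set ι | (∀ j, c j ≤ ((S j).filter (· ∈ ω)).card) ∧ ∃ j, r j ≤ ((S j).filter (· ∈ ω)).card}) := by
  refine osN_threshold_profileBoxOr_nonneg p F t S hSF hdisj (fun j => Option.elim j 0 c) (fun j => Option.elim j (F.card + 1) r)
    hU fun ω => ?_
  simp only [Set.mem_setOf_eq]
  constructor
  · rintro ⟨hc, j, hj⟩
    exact ⟨fun j' => by cases j' with | none => exact Nat.zero_le _ | some j' => exact hc j', some j, hj⟩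
  · rintro ⟨hc, j, hj⟩
    refine ⟨fun j' => hc (some j'), ?_⟩
    cases j with
    | none => have := card_filter_free_le F S ω; simp only [Option.elim] at hj; omega
    | some j => exact ⟨j, hj⟩

/-- **`(2′)` FOR AN AND OF THRESHOLDS OF DISJOINT BLOCKS.**  For every product measure, every block `F`, every `t`, every finite family
of pairwise disjoint `S_j ⊆ F` with thresholds `c_j`, and EVERY increasing event `U`: `0 ≤ n(1_U, 1_B)` at the slot `{N_F ≥ t}`,
`B = ⋂_j {N_{S_j} ≥ c_j}`. [this work] -/
theorem osN_threshold_disjointAnd_nonneg (p : ι → unitInterval) (F : Finset ι) (t : ℕ) {κ₀ : Type*} [Fintype κ₀]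
    [DecidableEq κ₀] (S : κ₀ → Finset ι) (hSF : ∀ j, S j ⊆ F) (hdisj : ∀ j j', j ≠ j' → Disjoint (S j) (S j')) (c : κ₀ → ℕ)
    {U : Set (Set ι)} (hU : IsUpperSet U) :
    0 ≤ osN p {ω : Set ι | t ≤ (F.filter (· ∈ ω)).card} (ind U)
      (ind {ω : Set ι | ∀ j, c j ≤ ((S j).filter (· ∈ ω)).card}) := by
  refine osN_threshold_profileBoxOr_nonneg p F t S hSF hdisj (fun j => Option.elim j 0 c) (fun _ => 0) hU fun ω => ?_
  simp only [Set.mem_setOf_eq]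
  constructor
  · intro hc
    exact ⟨fun j' => by cases j' with | none => exact Nat.zero_le _ | some j' => exact hc j', none, Nat.zero_le _⟩
  · rintro ⟨hc, -⟩
    exact fun j' => hc (some j')

omit [Fintype ι] [DecidableEq ι] in
/-- A box-and-OR of block thresholds is increasing. [folklore] -/
theorem isUpperSet_disjointBoxOr {κ₀ : Type*} (S : κ₀ → Finset ι) (c r : κ₀ → ℕ) :
    IsUpperSet {ω : Set ι | (∀ j, c j ≤ ((S j).filter (· ∈ ω)).card) ∧ ∃ j, r j ≤ ((S j).filter (· ∈ ω)).card} := by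
  intro ω ω' hle
  have hmono : ∀ j, ((S j).filter (· ∈ ω)).card ≤ ((S j).filter (· ∈ ω')).card := fun j =>
    card_le_card fun i hi => by rw [mem_filter] at hi ⊢; exact ⟨hi.1, hle hi.2⟩
  rintro ⟨hc, j, hj⟩
  exact ⟨fun j' => (hc j').trans (hmono j'), j, hj.trans (hmono j)⟩

omit [Fintype ι] [DecidableEq ι] in
/-- An AND of block thresholds is increasing. [folklore] -/
theorem isUpperSet_disjointAnd {κ₀ : Type*} (S : κ₀ → Finset ι) (c : κ₀ → ℕ) :
    IsUpperSet {ω : Set ι | ∀ j, c j ≤ ((S j).filter (· ∈ ω)).card} := by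
  intro ω ω' hle hc j
  exact (hc j).trans (card_le_card fun i hi => by rw [mem_filter] at hi ⊢; exact ⟨hi.1, hle hi.2⟩)

/-- **KAHN C5 / SAHI `C₃` for a Hamming threshold, a box-and-OR of thresholds of disjoint blocks and an arbitrary increasing event**,
every product measure: `0 ≤ E₃(1_{N_F ≥ t}, 1_U, 1_B)`. [this work] -/
theorem sahiE3_threshold_disjointBoxOr_nonneg (p : ι → unitInterval) (F : Finset ι) (t : ℕ) {κ₀ : Type*} [Fintype κ₀]
    [DecidableEq κ₀] (S : κ₀ → Finset ι) (hSF : ∀ j, S j ⊆ F) (hdisj : ∀ j j', j ≠ j' → Disjoint (S j) (S j')) (c r : κ₀ → ℕ)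
    {U : Set (Set ι)} (hU : IsUpperSet U) :
    0 ≤ sahiE3 (prodBernoulli p) {ω : Set ι | t ≤ (F.filter (· ∈ ω)).card} U
      {ω : Set ι | (∀ j, c j ≤ ((S j).filter (· ∈ ω)).card) ∧ ∃ j, r j ≤ ((S j).filter (· ∈ ω)).card} := by
  have hB := isUpperSet_disjointBoxOr S c r
  rw [← osT_ind_ind, osT_eq_osMp_add_osN]
  exact add_nonneg (osMp_threshold_nonneg_all p F t hU hB) (osN_threshold_disjointBoxOr_nonneg p F t S hSF hdisj c r hU)

/-- The same with the two slots exchanged. [this work] -/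
theorem sahiE3_threshold_disjointBoxOr_nonneg' (p : ι → unitInterval) (F : Finset ι) (t : ℕ) {κ₀ : Type*} [Fintype κ₀]
    [DecidableEq κ₀] (S : κ₀ → Finset ι) (hSF : ∀ j, S j ⊆ F) (hdisj : ∀ j j', j ≠ j' → Disjoint (S j) (S j')) (c r : κ₀ → ℕ)
    {U : Set (Set ι)} (hU : IsUpperSet U) :
    0 ≤ sahiE3 (prodBernoulli p) {ω : Set ι | t ≤ (F.filter (· ∈ ω)).card}
      {ω : Set ι | (∀ j, c j ≤ ((S j).filter (· ∈ ω)).card) ∧ ∃ j, r j ≤ ((S j).filter (· ∈ ω)).card} U := by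
  have hB := isUpperSet_disjointBoxOr S c r
  rw [← osT_ind_ind, osT_eq_osMp_add_osN, osN_comm]
  exact add_nonneg (osMp_threshold_nonneg_all p F t hB hU) (osN_threshold_disjointBoxOr_nonneg p F t S hSF hdisj c r hU)

/-- **KAHN C5 / SAHI `C₃` for a Hamming threshold, an AND of thresholds of disjoint blocks and an arbitrary increasing event**,
every product measure: `0 ≤ E₃(1_{N_F ≥ t}, 1_U, 1_{⋂_j {N_{S_j} ≥ c_j}})`. [this work] -/
theorem sahiE3_threshold_disjointAnd_nonneg (p : ι → unitInterval) (F : Finset ι) (t : ℕ) {κ₀ : Type*} [Fintype κ₀]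
    [DecidableEq κ₀] (S : κ₀ → Finset ι) (hSF : ∀ j, S j ⊆ F) (hdisj : ∀ j j', j ≠ j' → Disjoint (S j) (S j')) (c : κ₀ → ℕ)
    {U : Set (Set ι)} (hU : IsUpperSet U) :
    0 ≤ sahiE3 (prodBernoulli p) {ω : Set ι | t ≤ (F.filter (· ∈ ω)).card} U
      {ω : Set ι | ∀ j, c j ≤ ((S j).filter (· ∈ ω)).card} := by
  have hB := isUpperSet_disjointAnd S c
  rw [← osT_ind_ind, osT_eq_osMp_add_osN]
  exact add_nonneg (osMp_threshold_nonneg_all p F t hU hB) (osN_threshold_disjointAnd_nonneg p F t S hSF hdisj c hU)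

/-- The same with the two slots exchanged. [this work] -/
theorem sahiE3_threshold_disjointAnd_nonneg' (p : ι → unitInterval) (F : Finset ι) (t : ℕ) {κ₀ : Type*} [Fintype κ₀]
    [DecidableEq κ₀] (S : κ₀ → Finset ι) (hSF : ∀ j, S j ⊆ F) (hdisj : ∀ j j', j ≠ j' → Disjoint (S j) (S j')) (c : κ₀ → ℕ)
    {U : Set (Set ι)} (hU : IsUpperSet U) :
    0 ≤ sahiE3 (prodBernoulli p) {ω : Set ι | t ≤ (F.filter (· ∈ ω)).card}
      {ω : Set ι | ∀ j, c j ≤ ((S j).filter (· ∈ ω)).card} U := by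
  have hB := isUpperSet_disjointAnd S c
  rw [← osT_ind_ind, osT_eq_osMp_add_osN, osN_comm]
  exact add_nonneg (osMp_threshold_nonneg_all p F t hB hU) (osN_threshold_disjointAnd_nonneg p F t S hSF hdisj c hU)

end SahiOneStep

end Summit.CriticalPhenomena.PercolationContinuityZ3.Theorems
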